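import Mathlib
import HarnessLib
import Literature.Geometry.Lorentzian.KerrConvergence
import Literature.Geometry.Lorentzian.KerrWaveEnergy
import Summits.FinalStateConjecture.FinalStateConjecture.Theorems.BartnikGapSettlingGapExhaustionKerrRadiusSublevelConvex

/-!
# Route StarvedNecks — crux `FutureOrientedOfSeamed`, line `Sketch` (idea `clock-duality-rays`):
# stub `stub_ray` — rest-frame spatial rays join every slab point to the anchor sphere

For a boosted sub-extremal Kerr exterior `boostedKerrExterior Λ c M a`, radii `2M < R₀ ≤ ρ'` and a point
`x` of the exterior with rest-frame Kerr–Schild time `τ` and radius `≤ ρ'`, the boosted image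
`S = {Λ(τ, s ξ) + c | s between 1 and s⋆}` of a straight spatial ray segment of the rest frame
(`ξ` = spatial part of `x̂ = Λ⁻¹(x − c)`, `s⋆ ≥ 0` with `r(τ, s⋆ ξ) = R₀`) is preconnected, lies in the
exterior and in the slab `{t* = τ, r ≤ ρ'}`, passes through `x` (`s = 1`) and meets the sphere `{r = R₀}`.
Ingredients: `t*` is constant and the Kerr–Schild radius is MONOTONE along spatial rays from the origin
(`radius_ray_monotone`: the solid confocal ellipsoids `{r ≤ c}` are star-shaped, from the landed
`kerrSublevel_radius_lt_iff`), vanishes at the origin and is unbounded (`‖sξ‖² − a² ≤ r²`), so the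
intermediate value theorem cuts the ray at `r = R₀`.

References: B. O'Neill, *The geometry of Kerr black holes*, A K Peters 1995, Ch. 2, §2.1 (confocal
ellipsoids `{r = c}`); M. Visser, arXiv:0706.0622, (35).
-/

noncomputable section

-- `<Problem> = <Summit>` doubles the namespace component (tree-wide convention)
set_option linter.dupNamespace false

open Set Filter Topology Function
open scoped Manifold ContDiff ENNReal Topology
open Literature.Geometry.Lorentzian

namespace Summit.FinalStateConjecture.FinalStateConjecture.Theorems.FutureOrientedOfSeamed.ClockDualityRays

/-- Components of a ray point `(τ, s v)`: `(τ, s v)_{i+1} = s vᵢ`. [folklore] -/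
private theorem ray_apply (τ s : ℝ) (v : E3) :
    E4.ofTimeSpace τ (s • v) 1 = s * v 0 ∧ E4.ofTimeSpace τ (s • v) 2 = s * v 1 ∧
      E4.ofTimeSpace τ (s • v) 3 = s * v 2 := by
  refine ⟨?_, ?_, ?_⟩
  · have h := E4.ofTimeSpace_apply_succ τ (s • v) 0
    simpa using h
  · have h := E4.ofTimeSpace_apply_succ τ (s • v) 1
    simpa using h
  · have h := E4.ofTimeSpace_apply_succ τ (s • v) 2
    simpa using h

/-- **Ray monotonicity of the Kerr–Schild radius**: along a spatial ray from the origin at fixed `t*`,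
`r` is non-decreasing — the solid confocal ellipsoids `{r < c}` are the star-shaped quadrics
`c²(x₁² + x₂²) + (c² + a²)x₃² < c²(c² + a²)` (`kerrSublevel_radius_lt_iff`). (Adapted from the crux-ideate
sketch `Cruxes/FutureOrientedOfSeamed/SketchIdeator2.lean`, `radiusRayMonotone`.) O'Neill 1995, Ch. 2, §2.1.
[folklore] -/
theorem radius_ray_monotone (a τ : ℝ) (v : E3) {s s' : ℝ} (hs : 0 ≤ s) (hss' : s ≤ s') :
    Kerr.radius a (E4.ofTimeSpace τ (s • v)) ≤ Kerr.radius a (E4.ofTimeSpace τ (s' • v)) := by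
  by_contra hlt
  push Not at hlt
  obtain ⟨hy1, hy2, hy3⟩ := ray_apply τ s v
  obtain ⟨hy'1, hy'2, hy'3⟩ := ray_apply τ s' v
  set y := E4.ofTimeSpace τ (s • v) with hy
  set y' := E4.ofTimeSpace τ (s' • v) with hy'
  set c := Kerr.radius a y with hcdef
  have hc : 0 < c := (Kerr.radius_nonneg a y').trans_lt hlt
  have h1 := (Summit.FinalStateConjecture.FinalStateConjecture.Theorems.kerrSublevel_radius_lt_iff hc y').1 hlt
  have h2 : ¬ (Kerr.radius a y < c) := lt_irrefl _
  rw [Summit.FinalStateConjecture.FinalStateConjecture.Theorems.kerrSublevel_radius_lt_iff hc y] at h2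
  push Not at h2
  rw [hy1, hy2, hy3] at h2
  rw [hy'1, hy'2, hy'3] at h1
  have hQ : 0 ≤ c ^ 2 * (v 0 ^ 2 + v 1 ^ 2) + (c ^ 2 + a ^ 2) * v 2 ^ 2 := by positivity
  have hs2 : s ^ 2 ≤ s' ^ 2 := pow_le_pow_left₀ hs hss' 2
  have key : c ^ 2 * ((s * v 0) ^ 2 + (s * v 1) ^ 2) + (c ^ 2 + a ^ 2) * (s * v 2) ^ 2 ≤
      c ^ 2 * ((s' * v 0) ^ 2 + (s' * v 1) ^ 2) + (c ^ 2 + a ^ 2) * (s' * v 2) ^ 2 := by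
    have := mul_le_mul_of_nonneg_right hs2 hQ
    nlinarith [this]
  linarith

/-- The Kerr–Schild radius vanishes on the time axis: `r(τ, 0) = 0` (`r ≤ ‖x⃗‖`, here from
`r² = ((‖x⃗‖² − a²) + √((‖x⃗‖² − a²)² + 4a²x₃²))/2` with `x⃗ = 0`). Visser arXiv:0706.0622, (35). [folklore] -/
theorem radius_ofTimeSpace_zero_right (a τ : ℝ) : Kerr.radius a (E4.ofTimeSpace τ 0) = 0 := by
  have h3 : E4.ofTimeSpace τ (0 : E3) 3 = 0 := by
    have h := E4.ofTimeSpace_apply_succ τ (0 : E3) 2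
    simpa using h
  have hsq := Kerr.radius_sq a (E4.ofTimeSpace τ 0)
  rw [E4.spatialNorm_ofTimeSpace, norm_zero, h3] at hsq
  have hd : √((0 ^ 2 - a ^ 2) ^ 2 + 4 * a ^ 2 * 0 ^ 2 : ℝ) = a ^ 2 := by
    rw [show ((0 : ℝ) ^ 2 - a ^ 2) ^ 2 + 4 * a ^ 2 * 0 ^ 2 = (a ^ 2) ^ 2 by ring]
    exact Real.sqrt_sq (sq_nonneg a)
  rw [hd] at hsq
  have h0 : Kerr.radius a (E4.ofTimeSpace τ 0) ^ 2 = 0 := by rw [hsq]; ring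
  exact pow_eq_zero_iff (two_ne_zero) |>.mp h0

/-- The Kerr–Schild radius is unbounded along a nontrivial spatial ray: `s²‖v‖² − a² ≤ r(τ, s v)²`
(`‖x⃗‖² − a² ≤ r²`, `Kerr.spatialNorm_sq_sub_sq_le_radius_sq`). Visser arXiv:0706.0622, (35). [folklore] -/
theorem sq_norm_sub_sq_le_radius_ray_sq (a τ : ℝ) (v : E3) (s : ℝ) :
    (s * ‖v‖) ^ 2 - a ^ 2 ≤ Kerr.radius a (E4.ofTimeSpace τ (s • v)) ^ 2 := by
  have h := Kerr.spatialNorm_sq_sub_sq_le_radius_sq a (E4.ofTimeSpace τ (s • v))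
  rw [E4.spatialNorm_ofTimeSpace, norm_smul, Real.norm_eq_abs] at h
  calc (s * ‖v‖) ^ 2 - a ^ 2 = (|s| * ‖v‖) ^ 2 - a ^ 2 := by rw [mul_pow, mul_pow, sq_abs]
    _ ≤ _ := h

/-- `r₊ ≤ 2M` for `0 ≤ M` (`√(M² − a²) ≤ M`). O'Neill 1995, Ch. 2, §2.3. [folklore] -/
private theorem rPlus_le_two_mul_aux {M : ℝ} (hM : 0 ≤ M) (a : ℝ) : Kerr.rPlus M a ≤ 2 * M := by
  unfold Kerr.rPlus
  have h : √(M ^ 2 - a ^ 2) ≤ M := by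
    rw [Real.sqrt_le_left hM]
    nlinarith [sq_nonneg a]
  linarith

/-- **Stub `stub_ray` (the ray: every slab point is joined to the anchor sphere inside the slab).** For a
boosted sub-extremal Kerr exterior, `2M < R₀ ≤ ρ'`, and a point `x` of the exterior with rest-frame time `τ`
and rest-frame Kerr–Schild radius `≤ ρ'`, there is a preconnected set `S` in the exterior through `x`,
inside the slab `{t* = τ, r ≤ ρ'}`, containing a point of radius exactly `R₀` — the boosted image of a
straight spatial ray segment `s ↦ Λ(τ, s ξ) + c` of the rest frame, on which `t*` is constant and `r` is
monotone (star-shapedness of the solid confocal ellipsoids `{r ≤ c}`) and unbounded, cut at `r = R₀` by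
the intermediate value theorem. O'Neill 1995, Ch. 2, §2.1; Visser arXiv:0706.0622, (35). [folklore] -/
theorem stub_ray (M a : ℝ) (Λ : lorentzGroup) (c : E4) (hM : 0 < M) (hMa : Kerr.IsSubextremal M a)
    {R₀ ρ' τ : ℝ} (hR₀ : 2 * M < R₀) (hR₀ρ : R₀ ≤ ρ') (x : E4)
    (hx : x ∈ (boostedKerrExterior Λ c M a : Set E4)) (hxt : poincareInv Λ c x 0 = τ)
    (hxr : Kerr.radius a (poincareInv Λ c x) ≤ ρ') :
    ∃ S : Set E4, IsPreconnected S ∧ S ⊆ (boostedKerrExterior Λ c M a : Set E4) ∧ x ∈ S ∧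
      (∃ y ∈ S, Kerr.radius a (poincareInv Λ c y) = R₀) ∧
      ∀ z ∈ S, poincareInv Λ c z 0 = τ ∧ Kerr.radius a (poincareInv Λ c z) ≤ ρ' := by
  have _ := hMa
  -- rest-frame data of `x`
  obtain ⟨ξ, hξ⟩ : ∃ ξ : E3, poincareInv Λ c x = E4.ofTimeSpace τ ξ :=
    ⟨E4.spatial (poincareInv Λ c x), by
      rw [← hxt]; exact (E4.ofTimeSpace_time_spatial (poincareInv Λ c x)).symm⟩
  -- the boosted ray and its rest-frame radius
  let γ : ℝ → E4 := fun s ↦ (Λ : E4 ≃L[ℝ] E4) (E4.ofTimeSpace τ (s • ξ)) + c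
  let f : ℝ → ℝ := fun s ↦ Kerr.radius a (E4.ofTimeSpace τ (s • ξ))
  have hγinv : ∀ s, poincareInv Λ c (γ s) = E4.ofTimeSpace τ (s • ξ) := by
    intro s
    simp only [γ, poincareInv, add_sub_cancel_right, ContinuousLinearEquiv.symm_apply_apply]
  have hγ1 : γ 1 = x := by
    have h : (Λ : E4 ≃L[ℝ] E4) (poincareInv Λ c x) + c = x := by
      simp only [poincareInv, ContinuousLinearEquiv.apply_symm_apply, sub_add_cancel]
    simp only [γ, one_smul]
    rw [← hξ]
    exact h
  have hγc : Continuous γ :=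
    ((Λ : E4 ≃L[ℝ] E4).continuous.comp
      ((E4.continuous_ofTimeSpace τ).comp (continuous_id.smul continuous_const))).add continuous_const
  have hfc : Continuous f :=
    (Kerr.continuous_radius a).comp
      ((E4.continuous_ofTimeSpace τ).comp (continuous_id.smul continuous_const))
  have hf0 : f 0 = 0 := by
    show Kerr.radius a (E4.ofTimeSpace τ ((0 : ℝ) • ξ)) = 0
    rw [zero_smul]
    exact radius_ofTimeSpace_zero_right a τ
  have hf1 : f 1 = Kerr.radius a (poincareInv Λ c x) := by
    show Kerr.radius a (E4.ofTimeSpace τ ((1 : ℝ) • ξ)) = _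
    rw [one_smul, hξ]
  -- `r(x̂) > max r₊ 0`
  have hx' : max (Kerr.rPlus M a) 0 < Kerr.radius a (poincareInv Λ c x) := hx
  have hR₀pos : 0 < R₀ := by linarith
  have hrp : Kerr.rPlus M a < R₀ := (rPlus_le_two_mul_aux hM.le a).trans_lt hR₀
  have hmaxR₀ : max (Kerr.rPlus M a) 0 < R₀ := max_lt hrp hR₀pos
  -- `ξ ≠ 0`
  have hξ0 : ξ ≠ 0 := by
    intro h0
    rw [hξ, h0, radius_ofTimeSpace_zero_right] at hx'
    exact absurd hx' (not_lt.mpr (le_max_right _ _))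
  have hξn : 0 < ‖ξ‖ := norm_pos_iff.mpr hξ0
  -- a far parameter `s₂` with `f s₂ ≥ R₀`
  set s₂ : ℝ := (R₀ + |a| + 1) / ‖ξ‖ with hs₂def
  have hs₂ : 0 ≤ s₂ := by positivity
  have hs₂n : s₂ * ‖ξ‖ = R₀ + |a| + 1 := by
    rw [hs₂def, div_mul_cancel₀ _ hξn.ne']
  have hfs₂ : R₀ ≤ f s₂ := by
    have h := sq_norm_sub_sq_le_radius_ray_sq a τ ξ s₂
    rw [hs₂n] at h
    have hfn : 0 ≤ f s₂ := Kerr.radius_nonneg a _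
    have habs : 0 ≤ |a| := abs_nonneg a
    have hsq : a ^ 2 = |a| ^ 2 := (sq_abs a).symm
    by_contra hcon
    push Not at hcon
    have h1 : f s₂ ^ 2 < R₀ ^ 2 := by
      exact pow_lt_pow_left₀ hcon hfn two_ne_zero
    have h2 : (R₀ + |a| + 1) ^ 2 - a ^ 2 ≤ f s₂ ^ 2 := h
    nlinarith
  -- cut the ray at `r = R₀`
  obtain ⟨s₀, hs₀, hfs₀⟩ : ∃ s₀ ∈ Icc (0 : ℝ) s₂, f s₀ = R₀ :=
    intermediate_value_Icc hs₂ hfc.continuousOn ⟨by rw [hf0]; exact hR₀pos.le, hfs₂⟩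
  have hs₀0 : 0 ≤ s₀ := hs₀.1
  -- radius bounds along the segment between `1` and `s₀`
  have hseg : ∀ s ∈ uIcc (1 : ℝ) s₀,
      min (f 1) R₀ ≤ f s ∧ f s ≤ max (f 1) R₀ := by
    intro s hs
    rcases le_total 1 s₀ with h10 | h10
    · rw [uIcc_of_le h10] at hs
      have hlo : f 1 ≤ f s := radius_ray_monotone a τ ξ zero_le_one hs.1
      have hhi : f s ≤ f s₀ := radius_ray_monotone a τ ξ (zero_le_one.trans hs.1) hs.2
      rw [hfs₀] at hhi
      exact ⟨(min_le_left _ _).trans hlo, hhi.trans (le_max_right _ _)⟩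
    · rw [uIcc_of_ge h10] at hs
      have hlo : f s₀ ≤ f s := radius_ray_monotone a τ ξ hs₀0 hs.1
      have hhi : f s ≤ f 1 := radius_ray_monotone a τ ξ (hs₀0.trans hs.1) hs.2
      rw [hfs₀] at hlo
      exact ⟨(min_le_right _ _).trans hlo, hhi.trans (le_max_left _ _)⟩
  have hmin : max (Kerr.rPlus M a) 0 < min (f 1) R₀ := by
    rw [hf1]
    exact lt_min hx' hmaxR₀
  have hmax : max (f 1) R₀ ≤ ρ' := by
    rw [hf1]
    exact max_le hxr hR₀ρ
  refine ⟨γ '' uIcc 1 s₀, isPreconnected_uIcc.image γ hγc.continuousOn, ?_, ⟨1, left_mem_uIcc, hγ1⟩,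
    ⟨γ s₀, ⟨s₀, right_mem_uIcc, rfl⟩, by rw [hγinv]; exact hfs₀⟩, ?_⟩
  · rintro _ ⟨s, hs, rfl⟩
    show poincareInv Λ c (γ s) ∈ Kerr.exterior M a
    rw [hγinv, Kerr.mem_exterior]
    exact hmin.trans_le (hseg s hs).1
  · rintro _ ⟨s, hs, rfl⟩
    rw [hγinv]
    exact ⟨E4.ofTimeSpace_apply_zero τ _, ((hseg s hs).2).trans hmax⟩

end Summit.FinalStateConjecture.FinalStateConjecture.Theorems.FutureOrientedOfSeamed.ClockDualityRays

end
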